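import Summits.BirchSwinnertonDyer.BirchSwinnertonDyer.Theorems.ByReductionTypeAtTwoAdditivePotGoodDescentCountsBSDp
import Summits.BirchSwinnertonDyer.BirchSwinnertonDyer.Theorems.ByReductionTypeAtTwoAdditivePotGoodKatoHalf
import HarnessLib

/-!
# K4 crux `AdditiveRankZeroAtTwo` (item 19098), glue item 22620 `AdditiveRankZeroAtTwoSplitGlue`: an ALTERNATIVE
# COMPOSITION of the parent — on the potentially-good block the three open children C1″ (Conj A at 2), C2″ (rest of the
# Kato half), C3″ (Eisenstein half) and Kato's readings are replaced by ONE three-level DESCENT CERTIFICATE per class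
# (p652544 `bsdp_of_descentCounts`); the potentially-multiplicative block as in v2.2 (sibling + C4″ + Milne + Hoffstein–Luo)

Cell `bsd-2adic`, seat `bsd-2adic-k4-w2` GEN 0; `--supports stmt-BirchSwinnertonDyer-22620 --as helper` (a sibling of the
rendered glue, not a proof of it). HONEST FRAMING: conditional theorem; the per-class descent certificates are OBJECTS the
tree cannot compute (`n`-descent counts at four levels), and class-wide their existence is NOT a theorem of print — it is
BSD₂ on the block, instance by instance (p652544 / p651341 record both directions). Closes nothing at the `∀`-level; nothing
booked; BSD is not proved by any of this.

WHAT THIS FILE DOES. `additiveRankZeroAtTwo_of_potMultOverK_of_descentCertificates`: the parent `AdditiveRankZeroAtTwo`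
BY NAME from PRINT {GZK, modularity, Milne 1972 any-model, Hoffstein–Luo, Cassels, Cassels–Tate}, the sibling
`MultiplicativeRankZeroAtTwo` and the child C4″ `AdditivePotMultOverKAtTwo` BY NAME (pot-mult block, addL2x GEN 11 p627985
`addPotMult_bsdp_two_of_mult_of_overKC` verbatim), and, on the pot-good block, for every row SOME globally minimal member of
its class with: first descent `s ≤ t + 2`, counts at levels `2^k, 2^{k+1}, 2^{k+2}` with a strict then a flat step, and
`ord₂ #Ш_an = 2(k+1)` (then `BSDp` at the member by p652544, transported by Cassels, `TwistComparison.bsdp_of_bsdp_of_isIsogenous`).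
Compared with v2.2's `additiveRankZeroAtTwo_of_residual_v4` the binders `hmodN`, `hLim2`, `hFW`, `hSharp`, `hin`, `hAna` (C1″),
`hRest` (C2″), `hLow` (C3″) are GONE and `hCT` + the certificate slot come in. Census (evidence on 22617/22616): levels `2`, `4`
are two-engine on all 1 480 pot-good residue classes; the third level (`8` on 1 413 classes, `16`/`32` on 64/3) is not computed.

References: [SilvermanAEC2009] Thm. X.4.2, Thm. X.4.14; [Cassels1965ArithmeticVIII] / [MilneADT2006] Thm. I.7.3;
[Milne1972ArithmeticAV] Thm. 1; [HoffsteinLuo1997]; [Miller2011LMS] §1, Def. 1.1; [GrossZagier1986], [Kolyvagin1990].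
-/

set_option autoImplicit false
set_option linter.dupNamespace false

noncomputable section

open scoped Classical AddSubgroup

namespace Summit.BirchSwinnertonDyer.BirchSwinnertonDyer.Theorems.AddKatoTwo

open WeierstrassCurve Literature.NumberTheory.EllipticCurves
  Literature.NumberTheory.EllipticCurves.Rank1Residual
  Literature.NumberTheory.EllipticCurves.Rank1Residual.Typed
  Summit.BirchSwinnertonDyer.BirchSwinnertonDyer.Theorems
  Summit.BirchSwinnertonDyer.Rank1Residual.Additive
  Summit.BirchSwinnertonDyer.Rank1Residual.X5.AddTwoL2
  Summit.BirchSwinnertonDyer.Rank1Residual.AdditivePotMult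
  Summit.BirchSwinnertonDyer.BirchSwinnertonDyer.Theses.ByReductionTypeAtTwo

/-- **`BSD(E,2)` at an additive potentially-good rank-`0` curve from a three-level descent certificate at ANY globally
minimal member of its class** (p652544 `bsdp_of_descentCounts` at `W'`, then Cassels' transport of Miller's `BSD(E,p)`
along the isogeny). Reduction binders carried, not used. Conditional on `hCT`, Cassels `hCassels`, `hGZK`, modularity `hmod`
and the count slots. [cite: SilvermanAEC2009, Thm. X.4.2 and Thm. X.4.14] [cite: MilneADT2006, Thm. I.7.3]
[cite: Miller2011LMS, §1 and Def. 1.1] -/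
theorem addPotGood_bsdp_two_of_descentCounts_at_member (hCT : exists_casselsTate_pairing (K := ℚ))
    (hCassels : bsdRHS_eq_of_isIsogenous) (hGZK : rank_eq_analyticRank_of_analyticRank_le_one)
    (hmod : hasEntireLFunction_rat) (W : WeierstrassCurve ℚ) [W.IsElliptic] [W.IsGloballyMinimal]
    (_hcm : ¬ W.HasCM) (hr : W.analyticRank = 0) (_hadd : Addv W 2) (_hj : 0 ≤ padicValRat 2 W.j)
    (W' : WeierstrassCurve ℚ) [W'.IsElliptic] [W'.IsGloballyMinimal] (hiso : IsIsogenous W W') {s t : ℕ}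
    (hs : Nat.card (W'.selmerGroup 2) = 2 ^ s) (ht : Nat.card (W'.toAffine.Point[(2 : ℤ)]) = 2 ^ t) (hst : s ≤ t + 2)
    (k : ℕ) {s₁ t₁ s₂ t₂ s₃ t₃ : ℕ}
    (hs₁ : Nat.card (W'.selmerGroup (2 ^ k)) = 2 ^ s₁) (ht₁ : Nat.card (W'.toAffine.Point[((2 ^ k : ℕ) : ℤ)]) = 2 ^ t₁)
    (hs₂ : Nat.card (W'.selmerGroup (2 ^ (k + 1))) = 2 ^ s₂)
    (ht₂ : Nat.card (W'.toAffine.Point[((2 ^ (k + 1) : ℕ) : ℤ)]) = 2 ^ t₂)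
    (hs₃ : Nat.card (W'.selmerGroup (2 ^ (k + 1 + 1))) = 2 ^ s₃)
    (ht₃ : Nat.card (W'.toAffine.Point[((2 ^ (k + 1 + 1) : ℕ) : ℤ)]) = 2 ^ t₃)
    (hstrict : s₁ + t₂ < s₂ + t₁) (hflat : s₃ + t₂ = s₂ + t₃)
    {q' : ℚ} (hq' : shaAn W' = (q' : ℂ)) (hv' : padicValRat 2 q' = ((2 * (k + 1) : ℕ) : ℤ)) : BSDp W 2 := by
  haveI : Fact (Nat.Prime 2) := ⟨Nat.prime_two⟩
  have hr' : W'.analyticRank = 0 := by rw [← analyticRank_eq_of_isIsogenous' hiso, hr]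
  have hr1' : W'.analyticRank ≤ 1 := by rw [hr']; exact zero_le_one
  exact TwistComparison.bsdp_of_bsdp_of_isIsogenous W' W 2 hCassels hGZK hmod hiso.symm_of_charZero hr1'
    (bsdp_of_descentCounts W' 2 hCT hGZK hr' hs (by simpa only [Nat.cast_ofNat] using ht) hst k hs₁ ht₁ hs₂ ht₂ hs₃ ht₃
      hstrict hflat hq' hv')

/-- **The parent `AdditiveRankZeroAtTwo` from PRINT, the multiplicative sibling, the child C4″ BY NAME, and ONE three-level
descent certificate per potentially-good class** — an alternative composition to v2.2's glue in which the open pot-good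
children C1″/C2″/C3″ and Kato's readings do not occur. `hcert`: for every globally minimal non-CM `W` of analytic rank `0`,
additive and potentially good at `2`, SOME globally minimal `W' ∼_ℚ W` carries the first descent (`s ≤ t + 2`), counts at
levels `2^k, 2^{k+1}, 2^{k+2}` with a strict then a flat step, and `ord₂ #Ш_an(W') = 2(k+1)`. Class-wide `hcert` is NOT a
theorem (it is the pot-good block of the crux, row by row); the tree cannot compute it; nothing is closed. Conditional on
`hGZK`, `hmod`, `hMilneC`, `hHL`, `hCassels`, `hCT`, the sibling `hMult`, C4″ `hC4` and the slots.
[cite: SilvermanAEC2009, Thm. X.4.2 and Thm. X.4.14] [cite: MilneADT2006, Thm. I.7.3] [cite: Milne1972ArithmeticAV, Thm. 1]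
[cite: HoffsteinLuo1997, Theorem] [cite: Miller2011LMS, §1 and Def. 1.1] -/
theorem additiveRankZeroAtTwo_of_potMultOverK_of_descentCertificates
    (hGZK : rank_eq_analyticRank_of_analyticRank_le_one) (hmod : hasEntireLFunction_rat)
    (hMilneC : Milne1972.bsdQuotient_baseChange_quadratic_anyModel)
    (hHL : HoffsteinLuo1997_exists_twist_L_one_ne_zero)
    (hCassels : bsdRHS_eq_of_isIsogenous) (hCT : exists_casselsTate_pairing (K := ℚ))
    (hMult : MultiplicativeRankZeroAtTwo) (hC4 : AdditivePotMultOverKAtTwo)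
    (hcert : ∀ (W : WeierstrassCurve ℚ) [W.IsElliptic] [W.IsGloballyMinimal], ¬ W.HasCM → W.analyticRank = 0 →
      Addv W 2 → 0 ≤ padicValRat 2 W.j →
      ∃ (W' : WeierstrassCurve ℚ) (_ : W'.IsElliptic) (_ : W'.IsGloballyMinimal), IsIsogenous W W' ∧
        ∃ (s t k s₁ t₁ s₂ t₂ s₃ t₃ : ℕ) (q' : ℚ),
          Nat.card (W'.selmerGroup 2) = 2 ^ s ∧ Nat.card (W'.toAffine.Point[(2 : ℤ)]) = 2 ^ t ∧ s ≤ t + 2 ∧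
          Nat.card (W'.selmerGroup (2 ^ k)) = 2 ^ s₁ ∧ Nat.card (W'.toAffine.Point[((2 ^ k : ℕ) : ℤ)]) = 2 ^ t₁ ∧
          Nat.card (W'.selmerGroup (2 ^ (k + 1))) = 2 ^ s₂ ∧
          Nat.card (W'.toAffine.Point[((2 ^ (k + 1) : ℕ) : ℤ)]) = 2 ^ t₂ ∧
          Nat.card (W'.selmerGroup (2 ^ (k + 1 + 1))) = 2 ^ s₃ ∧
          Nat.card (W'.toAffine.Point[((2 ^ (k + 1 + 1) : ℕ) : ℤ)]) = 2 ^ t₃ ∧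
          s₁ + t₂ < s₂ + t₁ ∧ s₃ + t₂ = s₂ + t₃ ∧
          shaAn W' = (q' : ℂ) ∧ padicValRat 2 q' = ((2 * (k + 1) : ℕ) : ℤ)) :
    AdditiveRankZeroAtTwo := by
  unfold AdditiveRankZeroAtTwo
  intro W _ _ hcm hr hadd
  by_cases hj : 0 ≤ padicValRat 2 W.j
  · obtain ⟨W', hW'e, hW'm, hiso, s, t, k, s₁, t₁, s₂, t₂, s₃, t₃, q', hs, ht, hst, hs₁, ht₁, hs₂, ht₂, hs₃, ht₃,
      hstrict, hflat, hq', hv'⟩ := hcert W hcm hr hadd hj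
    haveI := hW'e
    haveI := hW'm
    exact addPotGood_bsdp_two_of_descentCounts_at_member hCT hCassels hGZK hmod W hcm hr hadd hj W' hiso hs ht hst k
      hs₁ ht₁ hs₂ ht₂ hs₃ ht₃ hstrict hflat hq' hv'
  · exact addPotMult_bsdp_two_of_mult_of_overKC hGZK hmod hMilneC hHL hMult hC4 W hcm hr hadd (lt_of_not_ge hj)

end Summit.BirchSwinnertonDyer.BirchSwinnertonDyer.Theorems.AddKatoTwo

end
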